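import Summits.MatrixMultiplication.MatrixMultiplication.Theorems.FarEdgeDescentSpecialClass
import Summits.MatrixMultiplication.MatrixMultiplication.Theorems.FarEdgeDescentZeroWeightMember
import HarnessLib

/-!
# Far-edge descent, Kernel XI-b (part 2) — the special value of the line caps the special stratum

Support for `Summit.MatrixMultiplication.MatrixMultiplication.Theses.FarEdgeDescent`
(aside `SubLogRate`; lens «structural dichotomy (special vs generic)», generation 36).

With the normal form, the symmetries and the transport of `FarEdgeDescentSpecialClass`, this
file decides the SPECIAL stratum of the support class
`V_S^{sp} = {T : supp T ⊆ supp 𝔖(1), some support entry of T vanishes}` over every INFINITE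
field `K`, in terms of the single special member `𝔖(0)` of the BCZ line:

* (§1) `Φ(T) ≤ Φ(𝔖(0))` for every universal spectral point `Φ` and every `T ∈ V_S^{sp}`
  (`spectralPoint_le_fam_zero_of_isSpecial`): at the deleted entry `p₀` the full-`supp 𝔖(0)`
  points are torus translates of `𝔖(0)`, they are Zariski dense in the coordinate subspace of
  `supp 𝔖(0)` (X-d §3), and `{Φ ≤ Φ(𝔖(0))}` is Zariski closed (CHNVZ); the other seven entries
  follow by transport along the symmetries of `𝔖(1)`;
* hence `R̃(T) ≤ R̃(𝔖(0))` on `V_S^{sp}` with equality at `𝔖(0) ∈ V_S^{sp}`: **the special value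
  `s := R̃(𝔖(0))` of the line is the maximum of `R̃` on the special stratum**
  (`isGreatest_asymptoticRank_special`), and likewise `Φ(𝔖(0)) = max_{V_S^{sp}} Φ` pointwise;
* (§2) the **structure theorem of the support class** (`supportClass_structure`): every
  `T ∈ V_S` is a nowhere-zero torus translate of some `𝔖(q)`, `q ≠ 0` — and then
  `R̃(T) = R̃(𝔖(q))` — or lies in `V_S^{sp}` and has `R̃(T) ≤ s`; with the coupling
  `|s − R̃(𝔖(q))| ≤ 1`;
* (§3) over `ℂ`: `max(4, 2^ω − 1) ≤ s ≤ min(6, r_gen)`, every special member has `R̃ ≤ 6`, and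
  under `ω = 2` every special member has `R̃ ≤ 5` (`≤ 4` once the generic value is `4`).

So the lens dichotomy on the `8`-dimensional orbit-closure-free class `V_S` is decided by two
numbers of the line: the generic value `r_gen = sup_{V_S} R̃` (X-d) and the special value
`s = max_{V_S^{sp}} R̃ = R̃(𝔖(0))` (this file), `r_gen − 1 ≤ s ≤ r_gen`.

## References

* M. Bläser, M. Christandl, J. Zuiddam, *The border support rank of two-by-two matrix
  multiplication is seven*, arXiv:1705.09652 (2017), Lemma 3, Def. 5.
  [BlaserChristandlZuiddam2017]
* M. Christandl, K. Hoeberechts, H. Nieuwboer, P. Vrana, J. Zuiddam, *Asymptotic tensor rank is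
  characterized by polynomials*, arXiv:2411.15789, Thm. 1.2 / Cor. 2.4, §3.
  [ChristandlHoeberechtsNieuwboerVranaZuiddam2025]
* V. Strassen, *The asymptotic spectrum of tensors*, J. reine angew. Math. 384 (1988),
  Thm. 3.9. [Strassen1988]
-/

noncomputable section

open scoped BigOperators

set_option linter.dupNamespace false

namespace Summit.MatrixMultiplication.MatrixMultiplication.Theorems.FarEdgeDescentSpecialValue

open Literature.Computability.AlgebraicComplexity
open Summit.MatrixMultiplication.MatrixMultiplication.Theorems.FarEdgeDescentSignTwist
open Summit.MatrixMultiplication.MatrixMultiplication.Theorems.FarEdgeDescentSignTwistDet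
open Summit.MatrixMultiplication.MatrixMultiplication.Theorems.FarEdgeDescentSignTwistComm
open Summit.MatrixMultiplication.MatrixMultiplication.Theorems.FarEdgeDescentSignTwistCommPow
open Summit.MatrixMultiplication.MatrixMultiplication.Theorems.FarEdgeDescentWeightFamily
open Summit.MatrixMultiplication.MatrixMultiplication.Theorems.FarEdgeDescentGenericDomination
open Summit.MatrixMultiplication.MatrixMultiplication.Theorems.FarEdgeDescentRankOneCoupling
open Summit.MatrixMultiplication.MatrixMultiplication.Theorems.FarEdgeDescentSpectralSublevel
open Summit.MatrixMultiplication.MatrixMultiplication.Theorems.FarEdgeDescentSupportClass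
open Summit.MatrixMultiplication.MatrixMultiplication.Theorems.FarEdgeDescentZeroWeightMember
open Summit.MatrixMultiplication.MatrixMultiplication.Theorems.FarEdgeDescentSpecialClass

/-! ## §1 The special stratum is capped by the special member (every infinite field) -/

section AnyField

variable {K : Type} [Field K]

/-- The SPECIAL stratum of the support class: supported inside `supp 𝔖(1)` and vanishing at some
support entry. [cite: BlaserChristandlZuiddam2017, Lemma 3] -/
def IsSpecial (T : Leaf2 → (Fin 2 × Fin 2) → Leaf2 → K) : Prop :=
  (∀ a x c, fam K 1 a x c = 0 → T a x c = 0) ∧ ∃ a x c, fam K 1 a x c ≠ 0 ∧ T a x c = 0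

/-- `𝔖(0)` itself is special: it vanishes at the deleted entry.
[cite: BlaserChristandlZuiddam2017, Def. 5] -/
theorem isSpecial_fam_zero : IsSpecial (fam K 0) :=
  ⟨fun _ _ _ h => fam_eq_zero_of_fam_one_eq_zero 0 h, Sum.inr (1, 0), (1, 0), Sum.inr (0, 0),
    by rw [fam_one_p₀]; exact one_ne_zero, fam_zero_p₀⟩

/-- A member of `V_S` is special or has the full support of `𝔖(1)`.
[cite: BlaserChristandlZuiddam2017, Lemma 3] -/
theorem isSpecial_or_sameSupport {T : Leaf2 → (Fin 2 × Fin 2) → Leaf2 → K}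
    (hT : ∀ a x c, fam K 1 a x c = 0 → T a x c = 0) :
    IsSpecial T ∨ SameSupport T (fam K 1) := by
  rcases sameSupport_or_exists_zero hT with h | h
  · exact Or.inr h
  · exact Or.inl ⟨hT, h⟩

/-- **Coupling of the two values**: `R̃(𝔖(q)) − 1 ≤ s ≤ R̃(𝔖(q)) + 1` for the special value
`s = R̃(𝔖(0))` and every `q`; in particular `r_gen − 1 ≤ s ≤ r_gen` for a dominant member.
[cite: BlaserChristandlZuiddam2017, Def. 5] -/
theorem special_value_coupling (q : K) :
    asymptoticRank (fam K q) - 1 ≤ asymptoticRank (fam K 0) ∧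
      asymptoticRank (fam K 0) ≤ asymptoticRank (fam K q) + 1 :=
  ⟨by linarith [asymptoticRank_fam_le_add_one q (0 : K)], asymptoticRank_fam_le_add_one 0 q⟩

open Classical in
/-- The support of `𝔖(0)` as a finite set of coordinates.
[cite: BlaserChristandlZuiddam2017, Def. 5] -/
def suppZero (K : Type) [Field K] : Finset (Leaf2 × (Fin 2 × Fin 2) × Leaf2) :=
  Finset.univ.filter fun z => fam K 0 z.1 z.2.1 z.2.2 ≠ 0

/-- Membership in `suppZero`. [cite: BlaserChristandlZuiddam2017, Def. 5] -/
theorem mem_suppZero (z : Leaf2 × (Fin 2 × Fin 2) × Leaf2) :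
    z ∈ suppZero K ↔ fam K 0 z.1 z.2.1 z.2.2 ≠ 0 := by
  simp [suppZero]

variable [Infinite K]

/-- **Cap at the deleted entry**: over an infinite field, every `T ∈ V_S` with `T(p₀) = 0` has
`Φ(T) ≤ Φ(𝔖(0))` for every universal spectral point — the full-`supp 𝔖(0)` points are torus
translates of `𝔖(0)`, they are Zariski dense in the coordinate subspace of `supp 𝔖(0)`, and
`{Φ ≤ Φ(𝔖(0))}` is Zariski closed (CHNVZ).
[cite: ChristandlHoeberechtsNieuwboerVranaZuiddam2025, Corollary 2.4, §3]
[cite: BlaserChristandlZuiddam2017, Lemma 3] -/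
theorem spectralPoint_le_fam_zero_of_p₀ {Φ : SpectralMap K} (hΦ : IsUniversalSpectralPoint K Φ)
    {T : Leaf2 → (Fin 2 × Fin 2) → Leaf2 → K} (hT : ∀ a x c, fam K 1 a x c = 0 → T a x c = 0)
    (h0 : T (Sum.inr (1, 0)) (1, 0) (Sum.inr (0, 0)) = 0) : Φ T ≤ Φ (fam K 0) := by
  refine spectralPoint_le_of_zariski_sublevel hΦ _ T fun p hp => ?_
  have hsub : ∀ z, z ∉ suppZero K → tensorEntries T z = 0 := fun z hz => by
    have hz' : fam K 0 z.1 z.2.1 z.2.2 = 0 := by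
      by_contra hne
      exact hz ((mem_suppZero z).2 hne)
    rcases fam_one_eq_zero_or_isP0 hz' with h1 | ⟨h1, h2, h3⟩
    · exact hT _ _ _ h1
    · show T z.1 z.2.1 z.2.2 = 0
      rw [h1, h2, h3]
      exact h0
  refine eval_eq_zero_of_support_subset (suppZero K) p (fun y hy => ?_) (tensorEntries T) hsub
  have hy1 : ∀ a x c, fam K 1 a x c = 0 → y (a, x, c) = 0 := fun a x c h => by
    by_contra hne
    exact (mem_suppZero _).1 ((hy (a, x, c)).1 hne) (fam_eq_zero_of_fam_one_eq_zero 0 h)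
  have hy0 : y (Sum.inr (1, 0), (1, 0), Sum.inr (0, 0)) = 0 := by
    by_contra hne
    exact (mem_suppZero _).1 ((hy _).1 hne) fam_zero_p₀
  have hyf : ∀ a x c, fam K 0 a x c ≠ 0 → y (a, x, c) ≠ 0 := fun a x c h =>
    (hy (a, x, c)).2 ((mem_suppZero _).2 h)
  obtain ⟨α, β, γ, hα, hβ, hγ, hEq⟩ :=
    exists_scale_fam_zero (T := fun a x c => y (a, x, c)) hy1 hy0 hyf
  have hte : tensorEntries (fun a b c => y (a, b, c)) = y := funext fun z => rfl
  have h := hp (fun a b c => y (a, b, c)) (by rw [hEq, spectralPoint_scale_eq hΦ hα hβ hγ])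
  rwa [hte] at h

/-- The cap at the deleted entry, as a `CapAt` statement at `pt 1 1 0`.
[cite: ChristandlHoeberechtsNieuwboerVranaZuiddam2025, §3] -/
theorem capAt_p₀ {Φ : SpectralMap K} (hΦ : IsUniversalSpectralPoint K Φ) :
    CapAt Φ (Φ (fam K 0)) (pt 1 1 0) := by
  rw [pt_one_one_zero]
  intro T hT h0
  exact spectralPoint_le_fam_zero_of_p₀ hΦ hT h0

/-- **The special stratum is capped by the special member, pointwise on the spectrum**:
`Φ(T) ≤ Φ(𝔖(0))` for every universal spectral point `Φ` and every special `T`, over every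
infinite field. [cite: ChristandlHoeberechtsNieuwboerVranaZuiddam2025, Corollary 2.4, §3]
[cite: BlaserChristandlZuiddam2017, Lemma 3] -/
theorem spectralPoint_le_fam_zero_of_isSpecial {Φ : SpectralMap K}
    (hΦ : IsUniversalSpectralPoint K Φ) {T : Leaf2 → (Fin 2 × Fin 2) → Leaf2 → K}
    (hT : IsSpecial T) : Φ T ≤ Φ (fam K 0) := by
  obtain ⟨hsub, a, x, c, hne, h0⟩ := hT
  obtain ⟨σ, i, k, hp⟩ := exists_pt_of_cond a x c ((fam_one_ne_zero_iff a x c).1 hne)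
  have h := capAt_all hΦ (capAt_p₀ hΦ) σ i k T hsub
  rw [← hp] at h
  exact h h0

/-- **`R̃(T) ≤ R̃(𝔖(0))` for every special `T`** (Strassen duality).
[cite: ChristandlHoeberechtsNieuwboerVranaZuiddam2025, Thm. 1.2] [cite: Strassen1988, Thm. 3.9] -/
theorem asymptoticRank_le_fam_zero_of_isSpecial {T : Leaf2 → (Fin 2 × Fin 2) → Leaf2 → K}
    (hT : IsSpecial T) : asymptoticRank T ≤ asymptoticRank (fam K 0) := by
  obtain ⟨F, hF, hFT⟩ := (strassen_duality_asymptoticRank_holds K T).2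
  rw [← hFT]
  exact (spectralPoint_le_fam_zero_of_isSpecial hF hT).trans
    ((strassen_duality_asymptoticRank_holds K (fam K 0)).1 F hF)

/-- **The special value of the line is the maximum of `R̃` on the special stratum**:
`R̃(𝔖(0)) = max {R̃(T) : T ∈ V_S^{sp}}`.
[cite: ChristandlHoeberechtsNieuwboerVranaZuiddam2025, Thm. 1.2] -/
theorem isGreatest_asymptoticRank_special :
    IsGreatest ((fun T => asymptoticRank T) '' {T : Leaf2 → (Fin 2 × Fin 2) → Leaf2 → K |
      IsSpecial T}) (asymptoticRank (fam K 0)) :=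
  ⟨⟨fam K 0, isSpecial_fam_zero, rfl⟩, by
    rintro _ ⟨T, hT, rfl⟩
    exact asymptoticRank_le_fam_zero_of_isSpecial hT⟩

/-- … and pointwise: `Φ(𝔖(0)) = max_{V_S^{sp}} Φ` for every universal spectral point `Φ`.
[cite: ChristandlHoeberechtsNieuwboerVranaZuiddam2025, §3] -/
theorem isGreatest_spectralPoint_special {Φ : SpectralMap K}
    (hΦ : IsUniversalSpectralPoint K Φ) :
    IsGreatest ((fun T => Φ T) '' {T : Leaf2 → (Fin 2 × Fin 2) → Leaf2 → K | IsSpecial T})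
      (Φ (fam K 0)) :=
  ⟨⟨fam K 0, isSpecial_fam_zero, rfl⟩, by
    rintro _ ⟨T, hT, rfl⟩
    exact spectralPoint_le_fam_zero_of_isSpecial hΦ hT⟩

/-- Level form: a bound holds on the whole special stratum iff it holds at `𝔖(0)`.
[cite: ChristandlHoeberechtsNieuwboerVranaZuiddam2025, Thm. 1.2] -/
theorem forall_special_le_iff (r : ℝ) :
    (∀ T : Leaf2 → (Fin 2 × Fin 2) → Leaf2 → K, IsSpecial T → asymptoticRank T ≤ r) ↔
      asymptoticRank (fam K 0) ≤ r :=
  ⟨fun h => h _ isSpecial_fam_zero,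
    fun h _ hT => (asymptoticRank_le_fam_zero_of_isSpecial hT).trans h⟩

/-! ## §2 The structure theorem of the support class -/

/-- **Structure theorem for the support class of `⟨2,2,2⟩`** (infinite field): a tensor
supported inside `supp 𝔖(1)` is EITHER a nowhere-zero torus translate of a member `𝔖(q)`,
`q ≠ 0`, of the punctured line — and then has exactly its asymptotic rank — OR special, with
`R̃ ≤ R̃(𝔖(0))`. [cite: BlaserChristandlZuiddam2017, Lemma 3]
[cite: ChristandlHoeberechtsNieuwboerVranaZuiddam2025, Thm. 1.2] -/
theorem supportClass_structure {T : Leaf2 → (Fin 2 × Fin 2) → Leaf2 → K}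
    (hT : ∀ a x c, fam K 1 a x c = 0 → T a x c = 0) :
    (∃ q : K, q ≠ 0 ∧ asymptoticRank T = asymptoticRank (fam K q) ∧
        ∃ (α : Leaf2 → K) (β : Fin 2 × Fin 2 → K) (γ : Leaf2 → K),
          (∀ a, α a ≠ 0) ∧ (∀ b, β b ≠ 0) ∧ (∀ c, γ c ≠ 0) ∧
            T = fun a b c => α a * β b * γ c * fam K q a b c) ∨
      (IsSpecial T ∧ asymptoticRank T ≤ asymptoticRank (fam K 0)) := by
  rcases isSpecial_or_sameSupport hT with h | h
  · exact Or.inr ⟨h, asymptoticRank_le_fam_zero_of_isSpecial h⟩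
  · obtain ⟨α, β, γ, q, hα, hβ, hγ, hq, hEq⟩ := exists_scale_fam_of_sameSupport h
    refine Or.inl ⟨q, hq, ?_, α, β, γ, hα, hβ, hγ, hEq⟩
    rw [hEq, asymptoticRank_scale_eq hα hβ hγ]

/-- **Every special member is within one of every member of the line**:
`R̃(T) ≤ R̃(𝔖(q)) + 1`, and `Φ(T) ≤ Φ(𝔖(q)) + 1` pointwise. [cite: Strassen1988, Thm. 3.9]
[cite: BlaserChristandlZuiddam2017, Def. 5] -/
theorem special_le_fam_add_one {T : Leaf2 → (Fin 2 × Fin 2) → Leaf2 → K} (hT : IsSpecial T)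
    (q : K) : asymptoticRank T ≤ asymptoticRank (fam K q) + 1 ∧
      ∀ Φ : SpectralMap K, IsUniversalSpectralPoint K Φ → Φ T ≤ Φ (fam K q) + 1 :=
  ⟨(asymptoticRank_le_fam_zero_of_isSpecial hT).trans (asymptoticRank_fam_le_add_one 0 q),
    fun _ hΦ => (spectralPoint_le_fam_zero_of_isSpecial hΦ hT).trans
      (spectralPoint_fam_le_add_one hΦ 0 q)⟩

end AnyField

/-! ## §3 Over `ℂ`: numeric windows for the special value and the special stratum -/

section Complex

/-- **Window for the special value** `s = R̃(𝔖(0)) = max_{V_S^{sp}} R̃` over `ℂ`: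
`max(4, 2^ω − 1) ≤ s ≤ 6` and `s ≤ r_gen = R̃(𝔖(q₀))` for a dominant `q₀` (which exists, X-a).
[cite: BlaserChristandlZuiddam2017, §2]
[cite: ChristandlHoeberechtsNieuwboerVranaZuiddam2025, Thm. 1.2] -/
theorem special_value_window :
    max 4 ((2 : ℝ) ^ omega ℂ - 1) ≤ asymptoticRank (fam ℂ 0) ∧ asymptoticRank (fam ℂ 0) ≤ 6 ∧
      ∃ q₀ : ℂ, (∀ q, asymptoticRank (fam ℂ q) ≤ asymptoticRank (fam ℂ q₀)) ∧
        asymptoticRank (fam ℂ q₀) - 1 ≤ asymptoticRank (fam ℂ 0) ∧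
          asymptoticRank (fam ℂ 0) ≤ asymptoticRank (fam ℂ q₀) := by
  obtain ⟨q₀, hq₀⟩ := exists_dominant_fam
  exact ⟨asymptoticRank_fam_zero_window.1, asymptoticRank_fam_zero_le_six, q₀, hq₀,
    (special_value_coupling q₀).1, hq₀ 0⟩

/-- **Every special member has `R̃ ≤ 6`** (and `≤ r_gen`), over `ℂ`.
[cite: BlaserChristandlZuiddam2017, §2] [cite: Strassen1988, Thm. 3.9] -/
theorem asymptoticRank_special_le_six {T : Leaf2 → (Fin 2 × Fin 2) → Leaf2 → ℂ}
    (hT : IsSpecial T) : asymptoticRank T ≤ 6 :=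
  (asymptoticRank_le_fam_zero_of_isSpecial hT).trans asymptoticRank_fam_zero_le_six

/-- **The summit pins both values**: if the generic value is `4` (equivalently `ω = 2`, X-a) then
the special value is `4` too. [conditional: MatrixMultiplication] -/
theorem special_value_eq_four_of_generic_eq_four {q₀ : ℂ}
    (hq₀ : ∀ q, asymptoticRank (fam ℂ q) ≤ asymptoticRank (fam ℂ q₀))
    (h4 : asymptoticRank (fam ℂ q₀) = 4) : asymptoticRank (fam ℂ 0) = 4 :=
  le_antisymm (h4 ▸ hq₀ 0) (four_le_asymptoticRank_fam 0)

/-- **Under the summit the special stratum is nearly flat**: every special member has `R̃ ≤ 5`,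
and `R̃ ≤ 4` as soon as every member of the line has `R̃ ≤ 4`.
[conditional: MatrixMultiplication] -/
theorem special_le_of_summit (hS : _root_.MatrixMultiplication)
    {T : Leaf2 → (Fin 2 × Fin 2) → Leaf2 → ℂ} (hT : IsSpecial T) :
    asymptoticRank T ≤ 5 ∧ ((∀ q, asymptoticRank (fam ℂ q) ≤ 4) → asymptoticRank T ≤ 4) :=
  ⟨(asymptoticRank_le_fam_zero_of_isSpecial hT).trans (asymptoticRank_fam_le_five_of_summit hS 0),
    fun h => (asymptoticRank_le_fam_zero_of_isSpecial hT).trans (h 0)⟩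

end Complex

end Summit.MatrixMultiplication.MatrixMultiplication.Theorems.FarEdgeDescentSpecialValue

end
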